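import Mathlib
import Summits.CriticalPhenomena.PercolationContinuityZ3.Theorems.PercNearOneGluingNoHeavyLowerTailOrderedDifferencesQuarticReduction

/-!
# Finite-field certificates for quartic unit classes (`ζ₅`, `ζ₁₀`, the `k5` quartic over `𝔽₁₆`)

Helper file for crux `stmt-CriticalPhenomena-4575` (`NoHeavyLowerTail`, route `PercNearOneGluingNoHeavy`), new-inequality factory
seat `prim-ineq-gen-3` (gen 29).  Everything here is PROVED; no definitions.  Discharges the two side hypotheses of
`…OrderedDifferencesQuarticReduction.linearIndependent_pencil_quartic_of_reduction` from finite checks modulo `p`: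

* `eq_zero_of_quartic_certificate` — if `X⁴ = uX³ + vX² + wX + r` has no root in a field `L` and no quadratic factor `X² = βX + γ`
  over `L` (stated as the non-vanishing of the explicit remainder pair), and `θ` is a root in an extension `ι : L →+* M`, then
  `ι a + ι b θ + ι e θ² + ι g θ³ = 0` forces `a = b = e = g = 0` (elementary division: a relation of degree `1, 2, 3` would give a
  root, a quadratic factor, or — via the cofactor `X + β − u` — again a root).
* `dvd_of_quartic_certificate_mod` — the same over `ZMod p ⊆ F` (`decide`-able hypotheses).
* `irreducible_of_quartic_certificate` — the mod-`p` certificate makes the integer quartic irreducible over `𝔽_p`, hence (monic) over `ℤ`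
  and, by Gauss's lemma, over `ℚ`; `int4_indep_of_irreducible` — then `1, t, t², t³` are `ℤ`-independent at every root `t` in
  characteristic `0` (minimal polynomial).
* `linearIndependent_pencil_quartic_of_finite_certificate` — ★ the packaged transfer: certificate mod `p` + independence of the pencil rows
  at `θ` (char `p`) ⟹ independence at `t` (char `0`).
* instances `linearIndependent_pencil_cyclotomicFive_of_charTwo` (`ζ₅`: `t⁴ = −t³ − t² − t − 1`), `…_cyclotomicTen_of_charTwo`
  (`ζ₁₀`: `t⁴ = t³ − t² + t − 1`), both via `θ⁴ = θ³ + θ² + θ + 1` over `𝔽₁₆`, and `…_kFiveQuartic_of_charTwo`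
  (`t⁴ = −2t³ + 2t² + 3t − 1`) via `θ⁴ = θ + 1` over `𝔽₁₆`: a machine check 'rank_{𝔽₁₆} U(θ) = |𝒜|' certifies (C0) for `𝒜` at these classes.
(prim-ineq-gen-3 gen 29, 2026-08-26.)
-/

namespace Summit.CriticalPhenomena.PercolationContinuityZ3.Theorems

namespace OrderedDifferences

open Finset Polynomial
open scoped FinsetFamily

variable {α : Type*} [DecidableEq α]

/-- **Mod-`p` style certificate ⟹ no relation of degree `≤ 3`.**  If the quartic `X⁴ = uX³ + vX² + wX + r` has no root in the field `L`
and no quadratic factor `X² = βX + γ` over `L` (the remainder of the quartic modulo `X² − βX − γ` is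
`(β³ + 2βγ − uβ² − uγ − vβ − w) X + (β²γ + γ² − uβγ − vγ − r)`), and `θ` is a root in a field `M ⊇ ι(L)`, then
`ι a + ι b θ + ι e θ² + ι g θ³ = 0` forces `a = b = e = g = 0`. -/
theorem eq_zero_of_quartic_certificate {L M : Type*} [Field L] [Field M] (ι : L →+* M) (u v w r : L) {θ : M}
    (hθ : θ * θ * θ * θ = ι u * θ * θ * θ + ι v * θ * θ + ι w * θ + ι r)
    (hno : ∀ s : L, s * s * s * s ≠ u * s * s * s + v * s * s + w * s + r)
    (hnoq : ∀ β γ : L, ¬ (β * β * β + β * γ + β * γ - u * (β * β) - u * γ - v * β - w = 0 ∧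
      β * β * γ + γ * γ - u * β * γ - v * γ - r = 0))
    (a b e g : L) (h : ι a + ι b * θ + ι e * θ * θ + ι g * θ * θ * θ = 0) : a = 0 ∧ b = 0 ∧ e = 0 ∧ g = 0 := by
  have hι := ι.injective
  have ne_of : ∀ x : L, x ≠ 0 → ι x ≠ 0 := fun x hx h0 => hx (hι (by rw [h0, map_zero]))
  have root : ∀ s : L, θ = ι s → False := by
    intro s hs
    apply hno s
    apply hι
    simp only [map_add, map_mul]
    rw [← hs]
    exact hθ
  -- a linear relation `ι c₁ θ + ι c₀ = 0` forces `c₁ = c₀ = 0`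
  have lin : ∀ c₀ c₁ : L, ι c₁ * θ + ι c₀ = 0 → c₁ = 0 ∧ c₀ = 0 := by
    intro c₀ c₁ hc
    by_cases h1 : c₁ = 0
    · subst h1
      refine ⟨rfl, hι ?_⟩
      rw [map_zero]
      simpa using hc
    · exfalso
      apply root (-c₀ / c₁)
      rw [map_div₀, map_neg, eq_div_iff (ne_of _ h1)]
      linear_combination hc
  -- a quadratic relation `θ² = ι β θ + ι γ` is impossible
  have quad : ∀ β γ : L, θ * θ = ι β * θ + ι γ → False := by
    intro β γ hq
    have key : ι (β * β * β + β * γ + β * γ - u * (β * β) - u * γ - v * β - w) * θ +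
        ι (β * β * γ + γ * γ - u * β * γ - v * γ - r) = 0 := by
      simp only [map_add, map_sub, map_mul]
      linear_combination hθ - (θ * θ + (ι β - ι u) * θ + (ι β * ι β + ι γ - ι u * ι β - ι v)) * hq
    obtain ⟨h1, h0⟩ := lin _ _ key
    exact hnoq β γ ⟨h1, h0⟩
  by_cases hg : g = 0
  · subst hg
    by_cases he : e = 0
    · subst he
      have h' : ι a + ι b * θ = 0 := by simpa using h
      obtain ⟨hb, ha⟩ := lin a b (by linear_combination h')
      exact ⟨ha, hb, rfl, rfl⟩
    · exfalso
      apply quad (-b / e) (-a / e)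
      have heι := ne_of e he
      have h' : ι a + ι b * θ + ι e * θ * θ = 0 := by simpa using h
      rw [map_div₀, map_div₀, map_neg, map_neg]
      field_simp
      linear_combination h'
  · exfalso
    have hgι := ne_of g hg
    -- cubic relation θ³ = β θ² + γ θ + δ
    set β := -e / g with hβ
    set γ := -b / g with hγ
    set δ := -a / g with hδ
    have hc : θ * θ * θ = ι β * θ * θ + ι γ * θ + ι δ := by
      rw [hβ, hγ, hδ, map_div₀, map_div₀, map_div₀, map_neg, map_neg, map_neg]
      field_simp
      linear_combination h
    have key : ι (β * β + γ - u * β - v) * θ * θ + ι (β * γ + δ - u * γ - w) * θ + ι (β * δ - u * δ - r) = 0 := by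
      simp only [map_add, map_sub, map_mul]
      linear_combination hθ - (θ + ι β - ι u) * hc
    by_cases hS2 : β * β + γ - u * β - v = 0
    · rw [hS2, map_zero, zero_mul, zero_mul, zero_add] at key
      obtain ⟨hS1, hS0⟩ := lin _ _ key
      apply hno (u - β)
      linear_combination ((u - β) * (u - β)) * hS2 + (u - β) * hS1 + hS0
    · apply quad (-(β * γ + δ - u * γ - w) / (β * β + γ - u * β - v)) (-(β * δ - u * δ - r) / (β * β + γ - u * β - v))
      have hS2ι := ne_of _ hS2
      have hdiv : θ * θ = (-ι (β * γ + δ - u * γ - w) * θ + -ι (β * δ - u * δ - r)) / ι (β * β + γ - u * β - v) := by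
        rw [eq_div_iff hS2ι]
        linear_combination key
      rw [map_div₀, map_div₀, map_neg, map_neg, hdiv]
      ring

/-- **Certificate modulo `p` ⟹ `1, θ, θ², θ³` independent over `𝔽_p`** (in any field of characteristic `p` containing a root `θ`). -/
theorem dvd_of_quartic_certificate_mod {F : Type*} [Field F] (p : ℕ) [Fact p.Prime] [CharP F p] (u v w r : ℤ) {θ : F}
    (hθ : θ * θ * θ * θ = (u : F) * θ * θ * θ + (v : F) * θ * θ + (w : F) * θ + (r : F))
    (hno : ∀ s : ZMod p, s * s * s * s ≠ (u : ZMod p) * s * s * s + (v : ZMod p) * s * s + (w : ZMod p) * s + (r : ZMod p))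
    (hnoq : ∀ β γ : ZMod p, ¬ (β * β * β + β * γ + β * γ - (u : ZMod p) * (β * β) - (u : ZMod p) * γ - (v : ZMod p) * β -
      (w : ZMod p) = 0 ∧ β * β * γ + γ * γ - (u : ZMod p) * β * γ - (v : ZMod p) * γ - (r : ZMod p) = 0))
    (a b e g : ℤ) (h : (a : F) + (b : F) * θ + (e : F) * θ * θ + (g : F) * θ * θ * θ = 0) :
    (p : ℤ) ∣ a ∧ (p : ℤ) ∣ b ∧ (p : ℤ) ∣ e ∧ (p : ℤ) ∣ g := by
  let ι : ZMod p →+* F := ZMod.castHom (dvd_refl p) F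
  have hθ' : θ * θ * θ * θ = ι (u : ZMod p) * θ * θ * θ + ι (v : ZMod p) * θ * θ + ι (w : ZMod p) * θ + ι (r : ZMod p) := by
    simpa [ι] using hθ
  have h' : ι (a : ZMod p) + ι (b : ZMod p) * θ + ι (e : ZMod p) * θ * θ + ι (g : ZMod p) * θ * θ * θ = 0 := by
    simpa [ι] using h
  obtain ⟨ha, hb, he, hg⟩ := eq_zero_of_quartic_certificate ι _ _ _ _ hθ' hno hnoq _ _ _ _ h'
  exact ⟨(ZMod.intCast_zmod_eq_zero_iff_dvd a p).mp ha, (ZMod.intCast_zmod_eq_zero_iff_dvd b p).mp hb,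
    (ZMod.intCast_zmod_eq_zero_iff_dvd e p).mp he, (ZMod.intCast_zmod_eq_zero_iff_dvd g p).mp hg⟩

/-- **The mod-`p` certificate makes the quartic irreducible over `𝔽_p`** (root in the algebraic closure; by
`eq_zero_of_quartic_certificate` its minimal polynomial has degree `4`). -/
theorem irreducible_mod_of_quartic_certificate (p : ℕ) [Fact p.Prime] (u v w r : ℤ)
    (hno : ∀ s : ZMod p, s * s * s * s ≠ (u : ZMod p) * s * s * s + (v : ZMod p) * s * s + (w : ZMod p) * s + (r : ZMod p))
    (hnoq : ∀ β γ : ZMod p, ¬ (β * β * β + β * γ + β * γ - (u : ZMod p) * (β * β) - (u : ZMod p) * γ - (v : ZMod p) * β -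
      (w : ZMod p) = 0 ∧ β * β * γ + γ * γ - (u : ZMod p) * β * γ - (v : ZMod p) * γ - (r : ZMod p) = 0)) :
    Irreducible (X ^ 4 - (C (u : ZMod p) * X ^ 3 + C (v : ZMod p) * X ^ 2 + C (w : ZMod p) * X + C (r : ZMod p)) : (ZMod p)[X]) := by
  set f : (ZMod p)[X] := X ^ 4 - (C (u : ZMod p) * X ^ 3 + C (v : ZMod p) * X ^ 2 + C (w : ZMod p) * X + C (r : ZMod p)) with hf
  have hmon : f.Monic := by
    apply Monic.sub_of_left (monic_X_pow 4)
    rw [degree_X_pow]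
    exact lt_of_le_of_lt degree_cubic_le (by exact_mod_cast (by norm_num : (3 : ℕ) < 4))
  have hdeg : f.natDegree = 4 := by
    rw [hf, natDegree_sub_eq_left_of_natDegree_lt, natDegree_X_pow]
    rw [natDegree_X_pow]
    exact lt_of_le_of_lt natDegree_cubic_le (by norm_num)
  let M := AlgebraicClosure (ZMod p)
  set ι : ZMod p →+* M := algebraMap (ZMod p) M with hι
  have hdegM : (f.map ι).degree ≠ 0 := by
    rw [degree_map, degree_eq_natDegree hmon.ne_zero, hdeg]
    exact_mod_cast (by norm_num : (4 : ℕ) ≠ 0)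
  obtain ⟨θ, hroot⟩ := IsAlgClosed.exists_root (f.map ι) hdegM
  have haeval : aeval θ f = 0 := by
    rw [IsRoot.def, eval_map_algebraMap] at hroot
    exact hroot
  have hθ : θ * θ * θ * θ = ι (u : ZMod p) * θ * θ * θ + ι (v : ZMod p) * θ * θ + ι (w : ZMod p) * θ + ι (r : ZMod p) := by
    have h := haeval
    simp only [hf, map_sub, map_add, map_mul, aeval_X_pow, aeval_C, aeval_X] at h
    linear_combination h
  -- the minimal polynomial of θ has degree ≥ 4
  have hint : IsIntegral (ZMod p) θ := ⟨f, hmon, by rwa [← aeval_def]⟩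
  have hmin4 : (4 : WithBot ℕ) ≤ (minpoly (ZMod p) θ).degree := by
    by_contra hlt
    push Not at hlt
    set q := minpoly (ZMod p) θ with hq
    have hqlt : q.natDegree < 4 := by
      rw [natDegree_lt_iff_degree_lt (minpoly.ne_zero hint)]
      exact hlt
    have hsum := aeval_eq_sum_range' hqlt θ
    rw [minpoly.aeval] at hsum
    simp only [Finset.sum_range_succ, Finset.sum_range_zero, zero_add, pow_zero, pow_succ, Algebra.smul_def] at hsum
    have hrel : ι (q.coeff 0) + ι (q.coeff 1) * θ + ι (q.coeff 2) * θ * θ + ι (q.coeff 3) * θ * θ * θ = 0 := by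
      rw [← hι] at hsum
      linear_combination -hsum
    obtain ⟨h0, h1, h2, h3⟩ := eq_zero_of_quartic_certificate ι _ _ _ _ hθ hno hnoq _ _ _ _ hrel
    apply minpoly.ne_zero hint
    rw [← hq, q.as_sum_range' 4 hqlt]
    simp [Finset.sum_range_succ, h0, h1, h2, h3]
  have hfe : f = minpoly (ZMod p) θ :=
    minpoly.unique_of_degree_le_degree_minpoly (ZMod p) θ hmon haeval (by
      rw [degree_eq_natDegree hmon.ne_zero, hdeg]; exact_mod_cast hmin4)
  rw [hfe]
  exact minpoly.irreducible hint

/-- **… hence irreducible over `ℚ`** (a monic integer polynomial irreducible modulo `p` is irreducible over `ℤ`, and by Gauss's lemma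
over `ℚ`). -/
theorem irreducible_rat_of_quartic_certificate (p : ℕ) [Fact p.Prime] (u v w r : ℤ)
    (hno : ∀ s : ZMod p, s * s * s * s ≠ (u : ZMod p) * s * s * s + (v : ZMod p) * s * s + (w : ZMod p) * s + (r : ZMod p))
    (hnoq : ∀ β γ : ZMod p, ¬ (β * β * β + β * γ + β * γ - (u : ZMod p) * (β * β) - (u : ZMod p) * γ - (v : ZMod p) * β -
      (w : ZMod p) = 0 ∧ β * β * γ + γ * γ - (u : ZMod p) * β * γ - (v : ZMod p) * γ - (r : ZMod p) = 0)) :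
    Irreducible (X ^ 4 - (C (u : ℚ) * X ^ 3 + C (v : ℚ) * X ^ 2 + C (w : ℚ) * X + C (r : ℚ)) : ℚ[X]) := by
  set fZ : ℤ[X] := X ^ 4 - (C u * X ^ 3 + C v * X ^ 2 + C w * X + C r) with hfZ
  have hmonZ : fZ.Monic := by
    apply Monic.sub_of_left (monic_X_pow 4)
    rw [degree_X_pow]
    exact lt_of_le_of_lt degree_cubic_le (by exact_mod_cast (by norm_num : (3 : ℕ) < 4))
  have hmap_p : fZ.map (Int.castRingHom (ZMod p)) =
      X ^ 4 - (C (u : ZMod p) * X ^ 3 + C (v : ZMod p) * X ^ 2 + C (w : ZMod p) * X + C (r : ZMod p)) := by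
    simp [hfZ, Polynomial.map_sub, Polynomial.map_add, Polynomial.map_mul, Polynomial.map_pow]
  have hirrZ : Irreducible fZ :=
    Monic.irreducible_of_irreducible_map (Int.castRingHom (ZMod p)) fZ hmonZ
      (by rw [hmap_p]; exact irreducible_mod_of_quartic_certificate p u v w r hno hnoq)
  have hirrQ := (Monic.irreducible_iff_irreducible_map_fraction_map (K := ℚ) hmonZ).mp hirrZ
  have hmap_q : fZ.map (algebraMap ℤ ℚ) = X ^ 4 - (C (u : ℚ) * X ^ 3 + C (v : ℚ) * X ^ 2 + C (w : ℚ) * X + C (r : ℚ)) := by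
    simp [hfZ, Polynomial.map_sub, Polynomial.map_add, Polynomial.map_mul, Polynomial.map_pow]
  rwa [hmap_q] at hirrQ

/-- **Irreducibility over `ℚ` ⟹ `1, t, t², t³` are `ℤ`-independent** at every root `t` of the quartic in a field of characteristic `0`
(the quartic is then the minimal polynomial of `t`, and a relation of degree `≤ 3` must vanish). -/
theorem int4_indep_of_irreducible {K : Type*} [Field K] [CharZero K] (u v w r : ℤ) {t : K}
    (ht : t * t * t * t = (u : K) * t * t * t + (v : K) * t * t + (w : K) * t + (r : K))
    (hirr : Irreducible (X ^ 4 - (C (u : ℚ) * X ^ 3 + C (v : ℚ) * X ^ 2 + C (w : ℚ) * X + C (r : ℚ)) : ℚ[X]))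
    (a b e g : ℤ) (h : (a : K) + (b : K) * t + (e : K) * t * t + (g : K) * t * t * t = 0) :
    a = 0 ∧ b = 0 ∧ e = 0 ∧ g = 0 := by
  set f : ℚ[X] := X ^ 4 - (C (u : ℚ) * X ^ 3 + C (v : ℚ) * X ^ 2 + C (w : ℚ) * X + C (r : ℚ)) with hf
  have hmon : f.Monic := by
    apply Monic.sub_of_left (monic_X_pow 4)
    rw [degree_X_pow]
    exact lt_of_le_of_lt degree_cubic_le (by exact_mod_cast (by norm_num : (3 : ℕ) < 4))
  have hdeg : f.natDegree = 4 := by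
    rw [hf, natDegree_sub_eq_left_of_natDegree_lt, natDegree_X_pow]
    rw [natDegree_X_pow]
    exact lt_of_le_of_lt natDegree_cubic_le (by norm_num)
  have haeval : aeval t f = 0 := by
    simp only [hf, map_sub, map_add, map_mul, aeval_X_pow, aeval_X, map_intCast]
    linear_combination ht
  have hmin : f = minpoly ℚ t := minpoly.eq_of_irreducible_of_monic hirr haeval hmon
  set P : ℚ[X] := C (g : ℚ) * X ^ 3 + C (e : ℚ) * X ^ 2 + C (b : ℚ) * X + C (a : ℚ) with hP
  have hPt : aeval t P = 0 := by
    simp only [hP, map_add, map_mul, aeval_X_pow, aeval_X, map_intCast]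
    linear_combination h
  by_cases hP0 : P = 0
  · have c0 : P.coeff 0 = (a : ℚ) := by simp [hP]
    have c1 : P.coeff 1 = (b : ℚ) := by
      rw [hP]; simp only [coeff_add, coeff_C_mul, coeff_X_pow, coeff_C, coeff_X]; norm_num
    have c2 : P.coeff 2 = (e : ℚ) := by
      rw [hP]; simp only [coeff_add, coeff_C_mul, coeff_X_pow, coeff_C, coeff_X]; norm_num
    have c3 : P.coeff 3 = (g : ℚ) := by
      rw [hP]; simp only [coeff_add, coeff_C_mul, coeff_X_pow, coeff_C, coeff_X]; norm_num
    rw [hP0, coeff_zero] at c0 c1 c2 c3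
    exact ⟨by exact_mod_cast c0.symm, by exact_mod_cast c1.symm, by exact_mod_cast c2.symm, by exact_mod_cast c3.symm⟩
  · exfalso
    have hle := minpoly.degree_le_of_ne_zero ℚ t hP0 hPt
    rw [← hmin, degree_eq_natDegree hmon.ne_zero, hdeg] at hle
    have hP3 : P.degree ≤ 3 := degree_cubic_le
    have h43 : (4 : WithBot ℕ) ≤ 3 := hle.trans hP3
    exact absurd h43 (by exact_mod_cast (by norm_num : ¬ (4 : ℕ) ≤ 3))

/-- **The packaged finite certificate, quartic case.**  `X⁴ = uX³ + vX² + wX + r` with no root and no quadratic factor modulo the prime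
`p` (two `decide`-able checks); `θ` a root in a field of characteristic `p`, `t` a root in a field of characteristic `0`: independence
of the pencil rows at `θ` implies independence at `t`. -/
theorem linearIndependent_pencil_quartic_of_finite_certificate (𝒜 : Finset (Finset α)) (u v w r : ℤ) (p : ℕ) [Fact p.Prime]
    (hno : ∀ s : ZMod p, s * s * s * s ≠ (u : ZMod p) * s * s * s + (v : ZMod p) * s * s + (w : ZMod p) * s + (r : ZMod p))
    (hnoq : ∀ β γ : ZMod p, ¬ (β * β * β + β * γ + β * γ - (u : ZMod p) * (β * β) - (u : ZMod p) * γ - (v : ZMod p) * β -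
      (w : ZMod p) = 0 ∧ β * β * γ + γ * γ - (u : ZMod p) * β * γ - (v : ZMod p) * γ - (r : ZMod p) = 0))
    {F : Type*} [Field F] [CharP F p] {θ : F} (hθ : θ * θ * θ * θ = (u : F) * θ * θ * θ + (v : F) * θ * θ + (w : F) * θ + (r : F))
    (hF : LinearIndependent F (fun A : 𝒜 => fun E : (𝒜 \\ 𝒜 : Finset (Finset α)) =>
      (if (E : Finset α) ⊆ (A : Finset α) then (1 : F) else 0) +
        θ * (if Disjoint (E : Finset α) (A : Finset α) then (1 : F) else 0)))
    {K : Type*} [Field K] [CharZero K] {t : K} (ht : t * t * t * t = (u : K) * t * t * t + (v : K) * t * t + (w : K) * t + (r : K)) :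
    LinearIndependent K (fun A : 𝒜 => fun E : (𝒜 \\ 𝒜 : Finset (Finset α)) =>
      (if (E : Finset α) ⊆ (A : Finset α) then (1 : K) else 0) +
        t * (if Disjoint (E : Finset α) (A : Finset α) then (1 : K) else 0)) :=
  linearIndependent_pencil_quartic_of_reduction 𝒜 u v w r (Fact.out : p.Prime).one_lt hθ
    (dvd_of_quartic_certificate_mod p u v w r hθ hno hnoq) hF ht
    (int4_indep_of_irreducible u v w r ht (irreducible_rat_of_quartic_certificate p u v w r hno hnoq))

/-- `X⁴ + X³ + X² + X + 1 = Φ₅` has no root modulo 2 (`ζ₅` form of the coefficients: `u = v = w = r = −1`). -/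
private theorem noRootMod2_phi5 : ∀ s : ZMod 2, s * s * s * s ≠ ((-1 : ℤ) : ZMod 2) * s * s * s + ((-1 : ℤ) : ZMod 2) * s * s +
    ((-1 : ℤ) : ZMod 2) * s + ((-1 : ℤ) : ZMod 2) := by
  decide
/-- `Φ₅` has no quadratic factor modulo 2. -/
private theorem noQuadMod2_phi5 : ∀ β γ : ZMod 2, ¬ (β * β * β + β * γ + β * γ - ((-1 : ℤ) : ZMod 2) * (β * β) -
    ((-1 : ℤ) : ZMod 2) * γ - ((-1 : ℤ) : ZMod 2) * β - ((-1 : ℤ) : ZMod 2) = 0 ∧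
    β * β * γ + γ * γ - ((-1 : ℤ) : ZMod 2) * β * γ - ((-1 : ℤ) : ZMod 2) * γ - ((-1 : ℤ) : ZMod 2) = 0) := by
  decide
/-- `Φ₁₀ = X⁴ − X³ + X² − X + 1 ≡ Φ₅ (mod 2)` has no root modulo 2 (`u = 1, v = −1, w = 1, r = −1`). -/
private theorem noRootMod2_phi10 : ∀ s : ZMod 2, s * s * s * s ≠ ((1 : ℤ) : ZMod 2) * s * s * s + ((-1 : ℤ) : ZMod 2) * s * s +
    ((1 : ℤ) : ZMod 2) * s + ((-1 : ℤ) : ZMod 2) := by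
  decide
/-- `Φ₁₀` has no quadratic factor modulo 2. -/
private theorem noQuadMod2_phi10 : ∀ β γ : ZMod 2, ¬ (β * β * β + β * γ + β * γ - ((1 : ℤ) : ZMod 2) * (β * β) -
    ((1 : ℤ) : ZMod 2) * γ - ((-1 : ℤ) : ZMod 2) * β - ((1 : ℤ) : ZMod 2) = 0 ∧
    β * β * γ + γ * γ - ((1 : ℤ) : ZMod 2) * β * γ - ((-1 : ℤ) : ZMod 2) * γ - ((-1 : ℤ) : ZMod 2) = 0) := by
  decide
/-- `X⁴ + 2X³ − 2X² − 3X + 1 ≡ X⁴ + X + 1 (mod 2)` has no root modulo 2 (`u = −2, v = 2, w = 3, r = −1`). -/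
private theorem noRootMod2_k5 : ∀ s : ZMod 2, s * s * s * s ≠ ((-2 : ℤ) : ZMod 2) * s * s * s + ((2 : ℤ) : ZMod 2) * s * s +
    ((3 : ℤ) : ZMod 2) * s + ((-1 : ℤ) : ZMod 2) := by
  decide
/-- `X⁴ + X + 1` has no quadratic factor modulo 2. -/
private theorem noQuadMod2_k5 : ∀ β γ : ZMod 2, ¬ (β * β * β + β * γ + β * γ - ((-2 : ℤ) : ZMod 2) * (β * β) -
    ((-2 : ℤ) : ZMod 2) * γ - ((2 : ℤ) : ZMod 2) * β - ((3 : ℤ) : ZMod 2) = 0 ∧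
    β * β * γ + γ * γ - ((-2 : ℤ) : ZMod 2) * β * γ - ((2 : ℤ) : ZMod 2) * γ - ((-1 : ℤ) : ZMod 2) = 0) := by
  decide

/-- **`ζ₅` class** `t⁴ = −t³ − t² − t − 1` (primitive fifth roots of unity): certificate over `𝔽₁₆` (`θ⁴ = θ³ + θ² + θ + 1` in
characteristic 2). -/
theorem linearIndependent_pencil_cyclotomicFive_of_charTwo (𝒜 : Finset (Finset α))
    {F : Type*} [Field F] [CharP F 2] {θ : F} (hθ : θ * θ * θ * θ = θ * θ * θ + θ * θ + θ + 1)
    (hF : LinearIndependent F (fun A : 𝒜 => fun E : (𝒜 \\ 𝒜 : Finset (Finset α)) =>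
      (if (E : Finset α) ⊆ (A : Finset α) then (1 : F) else 0) +
        θ * (if Disjoint (E : Finset α) (A : Finset α) then (1 : F) else 0)))
    {K : Type*} [Field K] [CharZero K] {t : K} (ht : t * t * t * t = -(t * t * t) - t * t - t - 1) :
    LinearIndependent K (fun A : 𝒜 => fun E : (𝒜 \\ 𝒜 : Finset (Finset α)) =>
      (if (E : Finset α) ⊆ (A : Finset α) then (1 : K) else 0) +
        t * (if Disjoint (E : Finset α) (A : Finset α) then (1 : K) else 0)) := by
  haveI : Fact (Nat.Prime 2) := ⟨by norm_num⟩
  have two : (2 : F) = 0 := by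
    have := CharP.cast_eq_zero F 2
    exact_mod_cast this
  refine linearIndependent_pencil_quartic_of_finite_certificate 𝒜 (-1) (-1) (-1) (-1) 2 noRootMod2_phi5 noQuadMod2_phi5 ?_ hF
    (by push_cast; linear_combination ht)
  push_cast
  linear_combination hθ + (θ * θ * θ + θ * θ + θ + 1) * two

/-- **`ζ₁₀` class** `t⁴ = t³ − t² + t − 1` (primitive tenth roots of unity): certificate over `𝔽₁₆` (`θ⁴ = θ³ + θ² + θ + 1`). -/
theorem linearIndependent_pencil_cyclotomicTen_of_charTwo (𝒜 : Finset (Finset α))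
    {F : Type*} [Field F] [CharP F 2] {θ : F} (hθ : θ * θ * θ * θ = θ * θ * θ + θ * θ + θ + 1)
    (hF : LinearIndependent F (fun A : 𝒜 => fun E : (𝒜 \\ 𝒜 : Finset (Finset α)) =>
      (if (E : Finset α) ⊆ (A : Finset α) then (1 : F) else 0) +
        θ * (if Disjoint (E : Finset α) (A : Finset α) then (1 : F) else 0)))
    {K : Type*} [Field K] [CharZero K] {t : K} (ht : t * t * t * t = t * t * t - t * t + t - 1) :
    LinearIndependent K (fun A : 𝒜 => fun E : (𝒜 \\ 𝒜 : Finset (Finset α)) =>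
      (if (E : Finset α) ⊆ (A : Finset α) then (1 : K) else 0) +
        t * (if Disjoint (E : Finset α) (A : Finset α) then (1 : K) else 0)) := by
  haveI : Fact (Nat.Prime 2) := ⟨by norm_num⟩
  have two : (2 : F) = 0 := by
    have := CharP.cast_eq_zero F 2
    exact_mod_cast this
  refine linearIndependent_pencil_quartic_of_finite_certificate 𝒜 1 (-1) 1 (-1) 2 noRootMod2_phi10 noQuadMod2_phi10 ?_ hF
    (by push_cast; linear_combination ht)
  push_cast
  linear_combination hθ + (θ * θ + 1) * two

/-- **The `k5` quartic class** `t⁴ = −2t³ + 2t² + 3t − 1` (`t⁴ + 2t³ − 2t² − 3t + 1 = 0`): certificate over `𝔽₁₆` (`θ⁴ = θ + 1`). -/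
theorem linearIndependent_pencil_kFiveQuartic_of_charTwo (𝒜 : Finset (Finset α))
    {F : Type*} [Field F] [CharP F 2] {θ : F} (hθ : θ * θ * θ * θ = θ + 1)
    (hF : LinearIndependent F (fun A : 𝒜 => fun E : (𝒜 \\ 𝒜 : Finset (Finset α)) =>
      (if (E : Finset α) ⊆ (A : Finset α) then (1 : F) else 0) +
        θ * (if Disjoint (E : Finset α) (A : Finset α) then (1 : F) else 0)))
    {K : Type*} [Field K] [CharZero K] {t : K} (ht : t * t * t * t = -2 * (t * t * t) + 2 * (t * t) + 3 * t - 1) :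
    LinearIndependent K (fun A : 𝒜 => fun E : (𝒜 \\ 𝒜 : Finset (Finset α)) =>
      (if (E : Finset α) ⊆ (A : Finset α) then (1 : K) else 0) +
        t * (if Disjoint (E : Finset α) (A : Finset α) then (1 : K) else 0)) := by
  haveI : Fact (Nat.Prime 2) := ⟨by norm_num⟩
  have two : (2 : F) = 0 := by
    have := CharP.cast_eq_zero F 2
    exact_mod_cast this
  refine linearIndependent_pencil_quartic_of_finite_certificate 𝒜 (-2) 2 3 (-1) 2 noRootMod2_k5 noQuadMod2_k5 ?_ hF
    (by push_cast; linear_combination ht)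
  push_cast
  linear_combination hθ + (θ * θ * θ - θ * θ - θ + 1) * two

end OrderedDifferences

end Summit.CriticalPhenomena.PercolationContinuityZ3.Theorems
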